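import Summits.BirchSwinnertonDyer.BirchSwinnertonDyer.Theorems.ResidualThetaTransportAtTwoAwayDefs
import Summits.BirchSwinnertonDyer.BirchSwinnertonDyer.Theorems.ResidualThetaTransportAtTwoResidualSignedLambdaLowerCMAtTwoRhoLayerPairingCompat
import Literature.NumberTheory.GaloisRepresentations.ContinuousH1AddHomAlgebraProofs
import HarnessLib

/-!
# K-d glue AWAY FROM `2`, part 1: the localisation at the top of the tower on cocycles, its naturality in the coefficients, its
# compatibility with the layer localisations, and the frame maps `jAway` / `locKer` / `locAway` unfolded

Route `ResidualThetaTransportAtTwo` (RTT), crux RSL_g `ResidualSignedLambdaLowerCMAtTwo` (stmt-BirchSwinnertonDyer-22608); LEAD `prover-bsd-wall-rtt-p2`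
g18 (`--supports 22608 --as helper`, closes nothing). THEOREMS ONLY (no definition, no instance, no `sorry`). BSD is not proved by any of this.
Frame of record: `Theorems/ResidualThetaTransportAtTwoAwayDefs.lean` (`Dlev`, `Dloc`, `jAway`, `locKer`, `locAway`, `AwayPins`, `AtTwoPins`) over
`Literature/…/GreenbergSelmerCofreeGaloisModule.lean` (`cofreeGaloisModule`, `kerGroup`, `kerLocOf`); design `Cruxes/…/AWAYTWO-FRAME-g18.md` §4 (c).

* §1 (generic discrete module `M`) `kerLocOf_oneCocycleClass` — `loc_∞ [φ] = [φ ∘ (U_{∞,v} → Γ_∞)]` (the `n = ∞` twin of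
  `layerLocOf_oneCocycleClass`, asked for by width seat w2 g19 to bridge GLOBAL Θ-Kummer data to the LOCAL pin `AtTwoPins.hc₂`);
  `kerLocOf_cohomologyMap` — naturality in the coefficients; `kerLocOf_resLe_layer` — `loc_∞ (res_{Γ_∞ ≤ Γ_n} y) = res_{U_∞ ≤ U_n} (loc_n y)`.
* §2 (the frame) `locKer_oneCocycleClass`, `locKer_resOfLe_layer` (a global class restricted from the layer `Γ_n` localises to the restriction of
  its layer localisation), `jAway_resLe` (`j_{n+1,k} ∘ res = j_{n,k}` and the general `m ≤ n` form), `locAway_eq` (unfolding).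

References: [SerreGaloisCohomology1997] I §2.2–2.5; [Kobayashi2003] (8.23); [PerrinRiou1994Invent] §3.6.1; [GreenbergVatsal2000] §2.
-/

set_option autoImplicit false
-- the Theorems namespace of this sub repeats the summit name by design (D-0017 nested layout)
set_option linter.dupNamespace false

noncomputable section

open scoped Classical

namespace Summit.BirchSwinnertonDyer.BirchSwinnertonDyer.Theorems.ThetaTransport

open CategoryTheory Field NumberField IsDedekindDomain
  Literature.NumberTheory.EllipticCurves Literature.NumberTheory.GaloisRepresentations
  Literature.NumberTheory.EllipticCurves.GreenbergSelmer Literature.NumberTheory.EllipticCurves.CyclotomicLayer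
  Literature.NumberTheory.EllipticCurves.Kato2004 ZpExtension
  Summit.BirchSwinnertonDyer.BirchSwinnertonDyer.Theorems.OnePair

/-! ## §1 `kerLocOf` on cocycles, naturality, compatibility with the layers -/

section Generic

variable {p : ℕ} [Fact p.Prime] {M : Type} [AddCommGroup M] [TopologicalSpace M] [DiscreteTopology M]
  (ρM : DiscreteGaloisModule ℚ M) (κ : ZpExtension ℚ p) (v : HeightOneSpectrum (𝓞 ℚ))

/-- **`loc_∞` on explicit cocycles**: the class of `φ ∘ (U_{∞,v} → Γ_∞)` (twin of `layerLocOf_oneCocycleClass`). [cite: Kobayashi2003, (8.23) (p. 18)]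
[cite: SerreGaloisCohomology1997, I §2.4] -/
theorem kerLocOf_oneCocycleClass (φ : contOneCocycles (subgroupRep ρM.toTopRep κ.kerSubgroup)) :
    kerLocOf ρM κ v (oneCocycleClass _ φ) =
      oneCocycleClass (subgroupRep (localRepOf ρM v) (kerGroup κ v))
        (contOneCocycles.pullback (resGalSubgroupOfEmb κ.kerSubgroup (closureEmb (K := ℚ) (v.adicCompletion ℚ)))
          (X := subgroupRep ρM.toTopRep κ.kerSubgroup) (Y := subgroupRep (localRepOf ρM v) (kerGroup κ v))
          (TopRep.ofHom ⟨ContinuousLinearMap.id ℤ M, fun _ ↦ rfl⟩) φ) := by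
  unfold kerLocOf
  rw [map_oneCocycleClass]

/-- **`loc_∞` is natural in the coefficients**: `loc_∞ ∘ f_* = f_* ∘ loc_∞` (twin of `layerLocOf_cohomologyMap`). [cite: Kobayashi2003, (8.23) (p. 18)] -/
theorem kerLocOf_cohomologyMap {M' : Type} [AddCommGroup M'] [TopologicalSpace M'] [DiscreteTopology M'] (ρM' : DiscreteGaloisModule ℚ M')
    (f : ρM.toTopRep ⟶ ρM'.toTopRep) (y : H1 ρM κ.kerSubgroup) :
    kerLocOf ρM' κ v (cohomologyMap (subgroupRepMap f κ.kerSubgroup) 1 y) =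
      cohomologyMap (subgroupRepMap (Y := localRepOf ρM' v) (TopRep.ofHom (f.hom.restrictField (v.adicCompletion ℚ))) (kerGroup κ v)) 1
        (kerLocOf ρM κ v y) := by
  obtain ⟨φ, rfl⟩ := oneCocycleClass_surjective _ y
  unfold kerLocOf
  rw [cohomologyMap_oneCocycleClass, map_oneCocycleClass, map_oneCocycleClass, cohomologyMap_oneCocycleClass]
  congr 1

/-- **Top-of-tower localisation vs. layer localisation**: for a class `y` of the layer `Γ_n`, `loc_∞ (res_{Γ_∞ ≤ Γ_n} y) = res_{U_∞ ≤ U_n} (loc_n y)`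
(both are the class of `φ` composed with `U_{∞,v} → Γ_n`). [cite: SerreGaloisCohomology1997, I §2.5] [cite: Kobayashi2003, (8.23) (p. 18)] -/
theorem kerLocOf_resLe_layer (n : ℕ) (y : H1 ρM (κ.layerSubgroup n)) :
    kerLocOf ρM κ v (resLe ρM.toTopRep (κ.kerSubgroup_le_layerSubgroup n) 1 y) =
      resLe (localRepOf ρM v) (kerGroup_le_layerGroup κ v n) 1 (layerLocOf ρM κ v n y) := by
  obtain ⟨φ, rfl⟩ := oneCocycleClass_surjective _ y
  rw [resLe_oneCocycleClass, kerLocOf_oneCocycleClass, layerLocOf_oneCocycleClass, resLe_oneCocycleClass]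
  exact congrArg _ (Subtype.ext (ContinuousMap.ext fun _ ↦ rfl))

end Generic

/-! ## §2 The frame maps on cocycles and along the layers -/

section Frame

variable (S : Set (PadicAlgCl 2)) (κ : ZpExtension ℚ 2) (ρ : FramedGaloisRep ℚ ↥(padicCoeffIntegers S) 2)

/-- **`locKer` on explicit cocycles** (the map the S4₂/EH texts call `loc₂` at `π.v` and whose kernel is S4₀'s guard): the class of the global
cocycle pulled back to `U_{∞,w}` — so a GLOBAL Θ-Kummer datum of `φ` read on `resGalSubgroupOfEmb …` IS a LOCAL Θ-Kummer datum of the pulled-back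
cocycle (the bridge from `CofreeSelmerTransfer.toZModPow_eq_zero_of_transfer`'s `hval` to `AtTwoPins.hc₂`). [cite: Kobayashi2003, (8.23) (p. 18)]
[cite: SerreGaloisCohomology1997, I §2.4] -/
theorem locKer_oneCocycleClass (w : HeightOneSpectrum (𝓞 ℚ))
    (φ : contOneCocycles (subgroupRep (cofreeGaloisModule S ρ).toTopRep κ.kerSubgroup)) :
    locKer S κ ρ w (oneCocycleClass _ φ) =
      oneCocycleClass (subgroupRep (localRepOf (cofreeGaloisModule S ρ) w) (kerGroup κ w))
        (contOneCocycles.pullback (resGalSubgroupOfEmb κ.kerSubgroup (closureEmb (K := ℚ) (w.adicCompletion ℚ)))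
          (X := subgroupRep (cofreeGaloisModule S ρ).toTopRep κ.kerSubgroup) (Y := subgroupRep (localRepOf (cofreeGaloisModule S ρ) w) (kerGroup κ w))
          (TopRep.ofHom ⟨ContinuousLinearMap.id ℤ (Cofree ρ ↥(padicCoeffField S)), fun _ ↦ rfl⟩) φ) :=
  kerLocOf_oneCocycleClass (cofreeGaloisModule S ρ) κ w φ

/-- **The cocycle values of that pull-back**: at `τ ∈ U_{∞,w}` it is `φ (res τ)`. [cite: SerreGaloisCohomology1997, I §2.4] -/
theorem locKer_pullback_apply (w : HeightOneSpectrum (𝓞 ℚ))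
    (φ : contOneCocycles (subgroupRep (cofreeGaloisModule S ρ).toTopRep κ.kerSubgroup)) (τ : ↥(kerGroup κ w)) :
    (contOneCocycles.pullback (resGalSubgroupOfEmb κ.kerSubgroup (closureEmb (K := ℚ) (w.adicCompletion ℚ)))
        (X := subgroupRep (cofreeGaloisModule S ρ).toTopRep κ.kerSubgroup) (Y := subgroupRep (localRepOf (cofreeGaloisModule S ρ) w) (kerGroup κ w))
        (TopRep.ofHom ⟨ContinuousLinearMap.id ℤ (Cofree ρ ↥(padicCoeffField S)), fun _ ↦ rfl⟩) φ).1 τ =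
      φ.1 (resGalSubgroupOfEmb κ.kerSubgroup (closureEmb (K := ℚ) (w.adicCompletion ℚ)) τ) :=
  rfl

/-- **A class restricted from the layer `Γ_n` localises to the restriction of its layer localisation**: `loc_∞ (res y) = res (loc_n y)` on `D_w`
(coefficients `A_ρ`). [cite: SerreGaloisCohomology1997, I §2.5] -/
theorem locKer_resLe_layer (w : HeightOneSpectrum (𝓞 ℚ)) (n : ℕ) (y : H1 (cofreeGaloisModule S ρ) (κ.layerSubgroup n)) :
    locKer S κ ρ w (resLe (cofreeGaloisModule S ρ).toTopRep (κ.kerSubgroup_le_layerSubgroup n) 1 y) =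
      resLe (localRepOf (cofreeGaloisModule S ρ) w) (kerGroup_le_layerGroup κ w n) 1 (layerLocOf (cofreeGaloisModule S ρ) κ w n y) :=
  kerLocOf_resLe_layer (cofreeGaloisModule S ρ) κ w n y

/-- **Unfolding `jAway`**: `j_{n,k} y = (A_ρ[2^k] ↪ A_ρ)_* (res_{U_∞ ≤ U_n} y)`. [cite: SerreGaloisCohomology1997, I §2.5] -/
theorem jAway_apply (w : HeightOneSpectrum (𝓞 ℚ)) (n k : ℕ) (y : Dlev S κ ρ w n k) :
    jAway S κ ρ w n k y =
      cohomologyMap (subgroupRepMap (Y := localRepOf (cofreeGaloisModule S ρ) w)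
        (cofreeTorsionLocalInclusion S ρ ((2 ^ k : ℕ) : ℤ) w) (kerGroup κ w)) 1
        (resLe (localRepOf (cofreeTorsionGaloisModule S ρ ((2 ^ k : ℕ) : ℤ)) w) (kerGroup_le_layerGroup κ w n) 1 y) :=
  rfl

/-- **`j` along the layers, one step**: `j_{n+1,k} (res_{U_{n+1} ≤ U_n} y) = j_{n,k} y` (`resLe_resLe_apply`). [cite: SerreGaloisCohomology1997, I §2.5] -/
theorem jAway_resLe_succ (w : HeightOneSpectrum (𝓞 ℚ)) (n k : ℕ) (y : Dlev S κ ρ w n k) :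
    jAway S κ ρ w (n + 1) k
        (resLe (localRepOf (cofreeTorsionGaloisModule S ρ ((2 ^ k : ℕ) : ℤ)) w) (SignedKatoOffTwo.LayerPairing.layerGroup_antitone κ w n) 1 y) =
      jAway S κ ρ w n k y := by
  rw [jAway_apply, jAway_apply, resLe_resLe_apply]

/-- **`j` along the layers, `m ≤ n`**: `j_{n,k} (res_{U_n ≤ U_m} y) = j_{m,k} y`. [cite: SerreGaloisCohomology1997, I §2.5] -/
theorem jAway_resLe (w : HeightOneSpectrum (𝓞 ℚ)) {m n : ℕ} (hU : layerGroup κ w n ≤ layerGroup κ w m) (k : ℕ) (y : Dlev S κ ρ w m k) :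
    jAway S κ ρ w n k (resLe (localRepOf (cofreeTorsionGaloisModule S ρ ((2 ^ k : ℕ) : ℤ)) w) hU 1 y) = jAway S κ ρ w m k y := by
  rw [jAway_apply, jAway_apply, resLe_resLe_apply]

/-- **Unfolding `locAway`**: the `(w, c)`-component of `s` is `loc_w` of the conjugate `conj_{c.out} s`. [cite: GreenbergVatsal2000, §2] -/
theorem locAway_eq (S₀ : Finset (HeightOneSpectrum (𝓞 ℚ))) (s : subgroupH1 κ.kerSubgroup (Cofree ρ ↥(padicCoeffField S))) (w : ↥S₀)
    (c : Cosets κ (w : HeightOneSpectrum (𝓞 ℚ))) :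
    locAway S κ ρ S₀ s w c = locKer S κ ρ w (conjH1 κ.kerSubgroup (Cofree ρ ↥(padicCoeffField S)) c.out s) :=
  rfl

end Frame

end Summit.BirchSwinnertonDyer.BirchSwinnertonDyer.Theorems.ThetaTransport

end
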